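import Summits.ResolutionOfSingularities.ResolutionOfSingularities.Theorems.FrobeniusLadderFInjectiveMacaulayficationTameWildSplit
import Summits.ResolutionOfSingularities.ResolutionOfSingularities.Theorems.FrobeniusLadderFInjectiveMacaulayficationH4LocTameDim2
import Summits.ResolutionOfSingularities.ResolutionOfSingularities.Theorems.FrobeniusLadderFInjectiveMacaulayficationWFixClosedAffineDim2OfLipman
import HarnessLib

/-!
# Door v30, hole #4: the DIMENSION-GRADED TAME/WILD glue and the chain's «dim ≤ 2 of the closed-point stub, modulo Lipman» theorem
# (crux `FInjectiveMacaulayfication` stmt-ResolutionOfSingularities-15315, chain w45a; res-L1-w45a-plan-1 R15.8 (3) «L3d»; Props = the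
# TEXTS of res-L1-w45a-stub-4's two landed rungs T2 `H4LocTameDim2.h4LocTameDim2_of_lipman` and W2
# `WFixClosedAffineDim2.wfixClosedAffineDim2_of_lipman'` verbatim, against `SliceableCentre`/`TameWildSplit` abbreviations; filer res-L1-w45a-stub-3)

[OURS · L1 W4.5a] Support file (`--supports stmt-ResolutionOfSingularities-15315 --as helper`); NOT a statement of any manuscript;
AI-written (AI review is weaker than expert review). Replaces the role of NOTHING in H. Hironaka's manuscript. No named fact introduced
(`Lipman1978SequenceFinite` is the tree's named fact, taken BY NAME as a hypothesis).

* `H4LocTameDimLe d` — 5e⁺ at TAME bad closed points `b` with `dim 𝒪_{X₁,b} ≤ d` (T2's text for `d = 2`; per-point, any `X₁`);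
* `WFixClosedAffineDimLe d` — the #4β datum at NON-tame bad closed points of AFFINE `X₁` with `dim X₁ ≤ d` (W2's text for `d = 2`);
* `ClosedCentreExistsAffineDimLe d` — #4β (`SliceableCentre.ClosedCentreExists`) restricted to affine `X₁` of dimension `≤ d`;
* `closedCentreExistsAffineDimLe_of_tame_of_wfix d` — the `by_cases TameAt` kernel of `TameWildSplit.closedCentreExists_of_tame_of_wfix`
  in graded form (the tame branch uses `dim 𝒪_{X₁,b} ≤ dim X₁ ≤ d` and the landed producer `PointFixableCentre.pointFixable_h4`);
* **`closedCentreExistsAffineDimLe2_of_lipman (hL : Lipman1978SequenceFinite) : ClosedCentreExistsAffineDimLe 2`** — door v30's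
  closed-point stub for affine surfaces, modulo Lipman 1978 ONLY (T2 ✓ p550151 + W2 ✓ p546812/`…OfLipman`).
The «affine» qualifier is inherited from W2's text (its global centre is the Lipman regular model's, built on an affine `X₁`).
-/

-- single-problem summit: the doubled namespace component is forced
set_option linter.dupNamespace false

noncomputable section

open AlgebraicGeometry CategoryTheory Literature.AlgebraicGeometry.Resolution TopologicalSpace IsLocalRing

namespace Summit.ResolutionOfSingularities.ResolutionOfSingularities.Theorems.FInjectiveMacaulayfication.TameWildSplit

open Summit.ResolutionOfSingularities.ResolutionOfSingularities.Theorems.FInjectiveMacaulayfication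
open SliceableCentre

/-! ## §1 The graded Props (texts of T2 / W2 for `d = 2`) -/

/-- **5e⁺ in stalk dimension `≤ d`** (`d = 2`: the text of `H4LocTameDim2.h4LocTameDim2_of_lipman`'s conclusion, abbreviated):
at a TAME bad closed point `b` with `dim 𝒪_{X₁,b} ≤ d`, a point-fix datum. [candidate statement, OURS] -/
def H4LocTameDimLe (d : ℕ) : Prop :=
  ∀ (p : ℕ), p.Prime → ∀ (k : Type) [Field k] [CharP k p] (X₁ : Scheme.{0}) (f₁ : X₁ ⟶ Spec (.of k)),
    IsSeparated f₁ → LocallyOfFiniteType f₁ → QuasiCompact f₁ → IsIntegral X₁ →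
    (∀ x : X₁, CMCl (X₁.presheaf.stalk x)) → Set.Finite {x : X₁ | ¬ FCl p (X₁.presheaf.stalk x)} →
    ∀ b : X₁, IsClosed ({b} : Set X₁) → ¬ FCl p (X₁.presheaf.stalk b) → TameAt X₁ b →
      ringKrullDim (X₁.presheaf.stalk b) ≤ d → PFixData p (X₁.presheaf.stalk b)

/-- **`WFixClosed` for AFFINE `X₁` of dimension `≤ d`** (`d = 2`: the text of `WFixClosedAffineDim2.wfixClosedAffineDim2_of_lipman'`'s
conclusion, abbreviated): at a NON-tame bad closed point, the #4β datum. [candidate statement, OURS] -/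
def WFixClosedAffineDimLe (d : ℕ) : Prop :=
  ∀ (p : ℕ), p.Prime → ∀ (k : Type) [Field k] [CharP k p] (X₁ : Scheme.{0}) (f₁ : X₁ ⟶ Spec (.of k)),
    IsSeparated f₁ → LocallyOfFiniteType f₁ → QuasiCompact f₁ → IsIntegral X₁ → topologicalKrullDim X₁ ≤ d → IsAffine X₁ →
    (∀ x : X₁, CMCl (X₁.presheaf.stalk x)) → Set.Finite {x : X₁ | ¬ FCl p (X₁.presheaf.stalk x)} →
    ∀ b : X₁, IsClosed ({b} : Set X₁) → ¬ FCl p (X₁.presheaf.stalk b) → ¬ TameAt X₁ b →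
      CentreData p X₁ b

/-- **#4β for AFFINE `X₁` of dimension `≤ d`**: `SliceableCentre.ClosedCentreExists` with `topologicalKrullDim X₁ ≤ d → IsAffine X₁ →`
inserted. [candidate statement, OURS] -/
def ClosedCentreExistsAffineDimLe (d : ℕ) : Prop :=
  ∀ (p : ℕ), p.Prime → ∀ (k : Type) [Field k] [CharP k p] (X₁ : Scheme.{0}) (f₁ : X₁ ⟶ Spec (.of k)),
    IsSeparated f₁ → LocallyOfFiniteType f₁ → QuasiCompact f₁ → IsIntegral X₁ → topologicalKrullDim X₁ ≤ d → IsAffine X₁ →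
    (∀ x : X₁, CMCl (X₁.presheaf.stalk x)) → Set.Finite {x : X₁ | ¬ FCl p (X₁.presheaf.stalk x)} →
    ∀ b : X₁, IsClosed ({b} : Set X₁) → ¬ FCl p (X₁.presheaf.stalk b) → CentreData p X₁ b

/-- The ungraded stubs imply the graded ones. [folklore] -/
theorem h4LocTameDimLe_of_h4LocTame (h : H4LocTame) (d : ℕ) : H4LocTameDimLe d :=
  fun p hp k _ _ X₁ f₁ hs hl hq hi hc hf b hbcl hb hn _ => h p hp k X₁ f₁ hs hl hq hi hc hf b hbcl hb hn

/-- The ungraded stubs imply the graded ones. [folklore] -/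
theorem wfixClosedAffineDimLe_of_wfixClosed (h : WFixClosed) (d : ℕ) : WFixClosedAffineDimLe d :=
  fun p hp k _ _ X₁ f₁ hs hl hq hi _ _ hc hf b hbcl hb hn => h p hp k X₁ f₁ hs hl hq hi hc hf b hbcl hb hn

/-- #4β implies its affine graded restriction. [folklore] -/
theorem closedCentreExistsAffineDimLe_of_closedCentreExists (h : ClosedCentreExists) (d : ℕ) : ClosedCentreExistsAffineDimLe d :=
  fun p hp k _ _ X₁ f₁ hs hl hq hi _ _ hc hf b hbcl hb => h p hp k X₁ f₁ hs hl hq hi hc hf b hbcl hb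

/-! ## §2 The graded kernel and the `d = 2` instance -/

/-- On a scheme of dimension `≤ d` every local ring has dimension `≤ d`. [folklore] -/
theorem ringKrullDim_stalk_le {X : Scheme.{0}} {d : ℕ} (hX : topologicalKrullDim X ≤ d) (x : X) :
    ringKrullDim (X.presheaf.stalk x) ≤ d := by
  rw [ringKrullDim_stalk_eq_coheight]
  exact_mod_cast (topologicalKrullDim_le_iff_forall_coheight_le X d).mp hX x

/-- **#4β for affine `X₁` of dimension `≤ d` from the graded TAME/WILD split**: case on `TameAt X₁ b`; tame ⇒
`dim 𝒪_{X₁,b} ≤ dim X₁ ≤ d`, so `H4LocTameDimLe d` gives a point-fix datum, globalised by `PointFixableCentre.pointFixable_h4`;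
wild ⇒ `WFixClosedAffineDimLe d` is the datum. [folklore assembly; OURS] -/
theorem closedCentreExistsAffineDimLe_of_tame_of_wfix (d : ℕ) (hT : H4LocTameDimLe d) (hW : WFixClosedAffineDimLe d) :
    ClosedCentreExistsAffineDimLe d := by
  intro p hp k _ _ X₁ f₁ hs hl hq hi hdim haff hc hf b hbcl hb
  by_cases hn : IsIntegrallyClosed (X₁.presheaf.stalk b)
  · exact PointFixableCentre.pointFixable_h4 p hp k X₁ f₁ hs hl hq hi hc hf b hbcl hb
      (hT p hp k X₁ f₁ hs hl hq hi hc hf b hbcl hb hn (ringKrullDim_stalk_le hdim b))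
  · exact hW p hp k X₁ f₁ hs hl hq hi hdim haff hc hf b hbcl hb hn

/-- T2 in graded form: `H4LocTameDimLe 2` modulo Lipman 1978 (res-L1-w45a-stub-4's `H4LocTameDim2.h4LocTameDim2_of_lipman`, p550151).
[folklore assembly; cite: Liu2002, Thm. 8.3.44 (PDF p. 427)] -/
theorem h4LocTameDimLe2_of_lipman (hL : Lipman1978SequenceFinite.{0}) : H4LocTameDimLe 2 :=
  fun p hp k _ _ X₁ f₁ hs hl hq hi hc hf b hbcl hb hn hd =>
    H4LocTameDim2.h4LocTameDim2_of_lipman hL p hp k X₁ f₁ hs hl hq hi hc hf b hbcl hb hn hd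

/-- W2 in graded form: `WFixClosedAffineDimLe 2` modulo Lipman 1978 (res-L1-w45a-stub-4's
`WFixClosedAffineDim2.wfixClosedAffineDim2_of_lipman'`). [folklore assembly; cite: Liu2002, Thm. 8.3.44 (PDF p. 427)] -/
theorem wfixClosedAffineDimLe2_of_lipman (hL : Lipman1978SequenceFinite.{0}) : WFixClosedAffineDimLe 2 :=
  fun p hp k _ _ X₁ f₁ hs hl hq hi hdim haff hc hf b hbcl hb hn =>
    WFixClosedAffineDim2.wfixClosedAffineDim2_of_lipman' hL p hp k X₁ f₁ hs hl hq hi hdim haff hc hf b hbcl hb hn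

/-- **DOOR v30's CLOSED-POINT STUB FOR AFFINE SURFACES, MODULO LIPMAN 1978 ONLY**: for `X₁` affine, integral, separated of finite type
over a field of characteristic `p`, of dimension `≤ 2`, with all stalks Cohen–Macaulay and finitely many non-F-closed points, every
non-F-closed closed point `b` carries the #4β datum: a non-zero ideal sheaf `J` with `b ∈ supp J` every blowing up along which is FULL
(domain, Cohen–Macaulay, parameter ideals Frobenius closed) at every point over `supp J`. (T2 + W2 + the graded split.)
[folklore assembly; cite: Liu2002, Thm. 8.3.44 (PDF p. 427)] -/
theorem closedCentreExistsAffineDimLe2_of_lipman (hL : Lipman1978SequenceFinite.{0}) : ClosedCentreExistsAffineDimLe 2 :=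
  closedCentreExistsAffineDimLe_of_tame_of_wfix 2 (h4LocTameDimLe2_of_lipman hL) (wfixClosedAffineDimLe2_of_lipman hL)

end Summit.ResolutionOfSingularities.ResolutionOfSingularities.Theorems.FInjectiveMacaulayfication.TameWildSplit

end
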